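import Literature.NumberTheory.Automorphic.LieAlgebraGLBracket
import Literature.NumberTheory.Automorphic.LieAlgebraGLNilpotentExp
import HarnessLib

/-!
# Brackets of weight vectors, an `𝔰𝔩₂`-string computation, and the count `dim 𝔤_α ≤ 1`
(characteristic `0`; towards Springer 8.1.2 from `𝔤^T ⊆ L(T)` on the DAG of
`Literature.NumberTheory.Automorphic.chevalley_isomorphism`)

Companion to `LieAlgebraGL.lean` (weight spaces `weightSpaceGL T χ`, the Lie algebra
`lieAlgebraGL T` with its differentials `tangentDeriv p A`), `LieAlgebraGLStabilizer.lean`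
(`tangentDeriv_conjConstPolyGL`, `tangentDeriv_mul`), `LieAlgebraGLBracket.lean` (the case `α = 1`
of the differentiated torus relation) and `LieAlgebraWeights.lean` (`adWeightSpace`,
`finite_adWeightSpace_ne_bot`), namespace `Literature.NumberTheory.Automorphic`. Elementary
ingredients of the Lie-algebraic proof that root spaces are lines (`RootSpaceLine.lean`), all
proved, no named facts:

* `mul_mem_weightSpaceGL`, `lie_mem_weightSpaceGL` — `(𝔤𝔩ₙ)_χ (𝔤𝔩ₙ)_ψ ⊆ (𝔤𝔩ₙ)_{χψ}` and the
  same for commutators (Springer 7.1.1);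
* `lie_eq_tangentDeriv_smul_of_mem_weightSpaceGL` — **`[H, M] = dp_1(H) · M`** for `H ∈ Lie(T)`,
  `M ∈ (𝔤𝔩ₙ)_α` and `p` a polynomial representing `α` (differentiate `t M t⁻¹ = α(t) M` at
  `t = 1`; Springer 4.4.15, `d Ad = ad`); `tangentDeriv_add_eq_zero_of_char_inv`
  (`d(α⁻¹)_1 = -dα_1` on `Lie(T)`);
* `adIterate_mem_weightSpaceGL`, `exists_adIterate_eq_zero` — `(ad e)^m M ∈ (𝔤𝔩ₙ)_{α^m χ}`, so
  `ad e` is nilpotent on weight vectors when `α` has infinite order (only finitely many weight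
  spaces of `Ad(T)` are non-zero);
* `sl2_eq_zero_of_lie_e_lie_f_eq_zero` — the **`𝔰𝔩₂`-string lemma** in an associative algebra over
  a field of characteristic `0`: if `[h, e] = 2e`, `[e, f] = h`, `[h, v] = m v` with `m ≥ 1`,
  `ad e` is nilpotent on `v` and `[e, [f, v]] = 0`, then `v = 0` (the relations
  `[f, v_{j+1}] = -c_{j+1} v_j`, `c_{j+1} = ∑_{i ≤ j} (m + 2i) > 0`, along `v_j = (ad e)^j v`;
  Humphreys, *Introduction to Lie Algebras*, §7.2 — no complete reducibility is used, and the
  relation `[h, f] = -2f` is *not* assumed); `sl2StringConst` (definition of the `c_j`). This is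
  deliberately more elementary than, and not a duplicate of, `Literature/Algebra/Lie/Sl2Strings.lean`
  (the `End V` version for Mathlib's `IsSl2Triple`, which needs an algebraically closed field and a
  diagonalisable `H`): here `e, f, h` are elements of any associative algebra, acting by commutators;
* **`finrank_le_one_of_sl2Data`** — the dimension count (the commutator with `f` is used as the
  proof-local linear map `mulLeft f - mulRight f`, i.e. Mathlib's `LieAlgebra.ad` for the
  commutator bracket): for an `𝔰𝔩₂`-type triple `(e, f, h)` with `e ∈ (𝔤𝔩ₙ)_α`, a subspace
  `S ⊆ (𝔤𝔩ₙ)_α` on which `ad h = 2` and which `ad f` carries into a subspace `W ⊆ Lie(T)`, one has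
  `dim S ≤ 1`: `ad f : S → W` is injective and its image meets
  `{H ∈ W | dp_1(H) = 0} ⊆ {H | [H, e] = 0}`, of codimension `≤ 1` in `W`, trivially.

## References

* [SpringerLAG1998] T. A. Springer, *Linear Algebraic Groups*, 2nd ed., Progress in
  Mathematics 9, Birkhäuser (1998): 4.4.15, 7.1.1, Cor. 8.1.2.
* [Humphreys1972] J. E. Humphreys, *Introduction to Lie Algebras and Representation Theory*,
  GTM 9, Springer (1972), §7.2.
-/

noncomputable section

open scoped MatrixGroups IsMulCommutative

namespace Literature.NumberTheory.Automorphic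

variable {k : Type*} [Field k] {n : Type*} [Fintype n] [DecidableEq n]
variable {T : Subgroup (GL n k)}

/-! ### Products and brackets of weight vectors -/

/-- `(𝔤𝔩ₙ)_χ · (𝔤𝔩ₙ)_ψ ⊆ (𝔤𝔩ₙ)_{χψ}`: `t (A B) t⁻¹ = (t A t⁻¹)(t B t⁻¹)`. [folklore] -/
theorem mul_mem_weightSpaceGL {χ ψ : ↥T →* kˣ} {A B : Matrix n n k} (hA : A ∈ weightSpaceGL T χ)
    (hB : B ∈ weightSpaceGL T ψ) : A * B ∈ weightSpaceGL T (χ * ψ) := by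
  intro t
  have hA' := hA t
  have hB' := hB t
  have hinv : ((t : GL n k) : Matrix n n k)⁻¹ * ((t : GL n k) : Matrix n n k) = 1 :=
    Matrix.nonsing_inv_mul _ (Matrix.isUnits_det_units (t : GL n k))
  calc ((t : GL n k) : Matrix n n k) * (A * B) * ((t : GL n k) : Matrix n n k)⁻¹
      = (((t : GL n k) : Matrix n n k) * A * ((t : GL n k) : Matrix n n k)⁻¹) *
          (((t : GL n k) : Matrix n n k) * B * ((t : GL n k) : Matrix n n k)⁻¹) := by
        simp only [Matrix.mul_assoc]
        rw [← Matrix.mul_assoc ((t : GL n k) : Matrix n n k)⁻¹ ((t : GL n k) : Matrix n n k), hinv,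
          Matrix.one_mul]
    _ = ((χ * ψ) t : k) • (A * B) := by
        rw [hA', hB', Matrix.smul_mul, Matrix.mul_smul, smul_smul, MonoidHom.mul_apply, Units.val_mul]

/-- `[(𝔤𝔩ₙ)_χ, (𝔤𝔩ₙ)_ψ] ⊆ (𝔤𝔩ₙ)_{χψ}` for the commutator bracket. [folklore] -/
theorem lie_mem_weightSpaceGL {χ ψ : ↥T →* kˣ} {A B : Matrix n n k} (hA : A ∈ weightSpaceGL T χ)
    (hB : B ∈ weightSpaceGL T ψ) : A * B - B * A ∈ weightSpaceGL T (χ * ψ) := by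
  have h1 := mul_mem_weightSpaceGL hA hB
  have h2 := mul_mem_weightSpaceGL hB hA
  rw [mul_comm ψ χ] at h2
  exact Submodule.sub_mem _ h1 h2

/-! ### Differentiating the torus relation: `[H, M] = dα(H) M` -/

/-- **`[H, M] = dα(H) · M` for `H ∈ Lie(T)` and a weight vector `M` of weight `α`.** If
`t M t⁻¹ = α(t) M` for `t ∈ T` and the algebraic character `α` is given by the polynomial `p`
(`α(t) = p(t)`), then for every `H ∈ Lie(T)`, `H M - M H = dp_1(H) · M`: the polynomials
`(x M x⁻¹)_{ij} - p(x) M_{ij}` vanish on `T`, and their differentials at `1` along `H` are the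
entries of `[H, M] - dp_1(H) M` (`tangentDeriv_conjConstPolyGL`; Springer 4.4.15, `d Ad = ad`,
and 4.4.10 (3)). The case `α = 1` is `lie_eq_zero_of_mem_lieAlgebraGL_of_forall_conj_eq` of
`LieAlgebraGLBracket.lean`. [cite: SpringerLAG1998, 4.4.15] -/
theorem lie_eq_tangentDeriv_smul_of_mem_weightSpaceGL {α : ↥T →* kˣ} {p : MvPolynomial (GLCoord n) k}
    (hp : ∀ t : ↥T, ((α t : kˣ) : k) = MvPolynomial.eval (glCoordFun (t : GL n k)) p)
    {M : Matrix n n k} (hM : M ∈ weightSpaceGL T α) {H : Matrix n n k} (hH : H ∈ lieAlgebraGL T) :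
    H * M - M * H = tangentDeriv p H • M := by
  have hp1 : MvPolynomial.eval (glCoordFun (1 : GL n k)) p = 1 := by
    have := hp 1
    rw [map_one, Units.val_one] at this
    exact this.symm
  ext i j
  have hmem : conjConstPolyGL M i j - p * MvPolynomial.C (M i j) ∈
      MvPolynomial.vanishingIdeal k (glCoordFun '' (T : Set (GL n k))) := by
    rw [MvPolynomial.mem_vanishingIdeal_iff]
    rintro _ ⟨t, ht, rfl⟩
    change MvPolynomial.eval (glCoordFun t) (conjConstPolyGL M i j - p * MvPolynomial.C (M i j)) = 0
    have hMt := hM ⟨t, ht⟩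
    rw [← Matrix.coe_units_inv] at hMt
    rw [map_sub, map_mul, eval_conjConstPolyGL, MvPolynomial.eval_C, hMt, ← hp ⟨t, ht⟩,
      Matrix.smul_apply, smul_eq_mul, sub_self]
  have h := (mem_lieAlgebraGL_iff.1 hH) _ hmem
  rw [tangentDeriv_sub, tangentDeriv_conjConstPolyGL, tangentDeriv_mul, tangentDeriv_C, mul_zero,
    zero_add, MvPolynomial.eval_C, sub_eq_zero] at h
  rw [h, Matrix.smul_apply, smul_eq_mul]

/-- The differentials of (polynomials representing) a character and its inverse are opposite on
`Lie(T)`: `d(α⁻¹)_1 = -dα_1` (differentiate `p q = 1` on `T`). [folklore] -/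
theorem tangentDeriv_add_eq_zero_of_char_inv {α : ↥T →* kˣ} {p q : MvPolynomial (GLCoord n) k}
    (hp : ∀ t : ↥T, ((α t : kˣ) : k) = MvPolynomial.eval (glCoordFun (t : GL n k)) p)
    (hq : ∀ t : ↥T, ((α⁻¹ t : kˣ) : k) = MvPolynomial.eval (glCoordFun (t : GL n k)) q)
    {H : Matrix n n k} (hH : H ∈ lieAlgebraGL T) : tangentDeriv p H + tangentDeriv q H = 0 := by
  have hp1 : MvPolynomial.eval (glCoordFun (1 : GL n k)) p = 1 := by
    have := hp 1; rw [map_one, Units.val_one] at this; exact this.symm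
  have hq1 : MvPolynomial.eval (glCoordFun (1 : GL n k)) q = 1 := by
    have := hq 1; rw [map_one, Units.val_one] at this; exact this.symm
  have hmem : p * q - 1 ∈ MvPolynomial.vanishingIdeal k (glCoordFun '' (T : Set (GL n k))) := by
    rw [MvPolynomial.mem_vanishingIdeal_iff]
    rintro _ ⟨t, ht, rfl⟩
    change MvPolynomial.eval (glCoordFun t) (p * q - 1) = 0
    rw [map_sub, map_mul, map_one, ← hp ⟨t, ht⟩, ← hq ⟨t, ht⟩, MonoidHom.inv_apply,
      Units.val_inv_eq_inv_val, mul_inv_cancel₀ (Units.ne_zero _), sub_self]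
  have h := (mem_lieAlgebraGL_iff.1 hH) _ hmem
  rw [tangentDeriv_sub, tangentDeriv_mul, hp1, hq1, one_mul, mul_one, ← MvPolynomial.C_1,
    tangentDeriv_C, sub_zero] at h
  rwa [add_comm]

/-! ### `ad e` is nilpotent on weight vectors when `e` has a weight of infinite order -/

/-- Iterated brackets `(ad e)^m M` of a weight vector `e ∈ (𝔤𝔩ₙ)_α` with `M ∈ (𝔤𝔩ₙ)_χ` lie in
`(𝔤𝔩ₙ)_{α^m χ}`. [folklore] -/
theorem adIterate_mem_weightSpaceGL {α χ : ↥T →* kˣ} {e M : Matrix n n k} (he : e ∈ weightSpaceGL T α)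
    (hM : M ∈ weightSpaceGL T χ) (m : ℕ) :
    (fun X => e * X - X * e)^[m] M ∈ weightSpaceGL T (α ^ m * χ) := by
  induction m with
  | zero =>
    have e0 : α ^ 0 * χ = χ := by ext; simp
    rw [Function.iterate_zero_apply, e0]
    exact hM
  | succ m ih =>
    have h := lie_mem_weightSpaceGL he ih
    have e2 : α * (α ^ m * χ) = α ^ (m + 1) * χ := by
      ext; simp [pow_succ, mul_comm, mul_left_comm]
    rw [e2] at h
    rw [Function.iterate_succ_apply']
    exact h

/-- **`ad e` is nilpotent on every weight vector, for `e` a weight vector of a character `α` of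
infinite order** (e.g. a non-trivial character of a Zariski-connected `T`): the weight spaces
`(𝔤𝔩ₙ)_{α^m χ}`, `m ∈ ℕ`, are pairwise distinct members of the independent family of
`Ad(T)`-weight spaces, of which only finitely many are non-zero (`finite_adWeightSpace_ne_bot`).
[folklore] -/
theorem exists_adIterate_eq_zero [PerfectField k] [IsMulCommutative ↥T]
    (hss : ∀ t ∈ T, IsSemisimpleElt t) {α χ : ↥T →* kˣ} (hα : ∀ m : ℕ, 0 < m → α ^ m ≠ 1)
    {e M : Matrix n n k} (he : e ∈ weightSpaceGL T α) (hM : M ∈ weightSpaceGL T χ) :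
    ∃ m : ℕ, (fun X => e * X - X * e)^[m] M = 0 := by
  by_contra hall
  push Not at hall
  -- the weights `α^m χ` as functions `T → k` are pairwise distinct
  let w : ℕ → (↥T → k) := fun m t => (((α ^ m * χ) t : kˣ) : k)
  have hw : Function.Injective w := by
    intro m m' hmm'
    by_contra hne
    wlog hlt : m < m' generalizing m m'
    · exact this hmm'.symm (Ne.symm hne) (lt_of_le_of_ne (not_lt.1 hlt) (Ne.symm hne))
    apply hα (m' - m) (Nat.sub_pos_of_lt hlt)
    refine MonoidHom.ext fun t => Units.ext ?_
    have h := congrFun hmm' t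
    simp only [w, MonoidHom.mul_apply, MonoidHom.pow_apply, Units.val_mul, Units.val_pow_eq_pow_val]
      at h
    rw [MonoidHom.pow_apply, MonoidHom.one_apply, Units.val_pow_eq_pow_val, Units.val_one]
    have hχ : ((χ t : kˣ) : k) ≠ 0 := Units.ne_zero _
    have hαt : ((α t : kˣ) : k) ≠ 0 := Units.ne_zero _
    have h' : ((α t : kˣ) : k) ^ m = ((α t : kˣ) : k) ^ m' := mul_right_cancel₀ hχ h
    rw [← Nat.sub_add_cancel hlt.le, pow_add] at h'
    exact (mul_eq_right₀ (pow_ne_zero _ hαt)).1 h'.symm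
  -- each weight space `(𝔤𝔩ₙ)_{α^m χ}` is non-zero
  have hne : ∀ m : ℕ, adWeightSpace T (w m) ≠ ⊥ := by
    intro m hbot
    have hmem : (fun X => e * X - X * e)^[m] M ∈ adWeightSpace T (w m) := by
      rw [← weightSpaceGL_eq_adWeightSpace]
      exact adIterate_mem_weightSpaceGL he hM m
    rw [hbot, Submodule.mem_bot] at hmem
    exact hall m hmem
  have hfin := finite_adWeightSpace_ne_bot T hss
  exact Set.infinite_of_injective_forall_mem hw hne hfin

/-! ### An `𝔰𝔩₂`-string computation in an associative algebra (characteristic `0`) -/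

section Sl2String

variable {A : Type*} [Ring A] [Algebra k A]

/-- The recursion constants `c_j = ∑_{i<j} (m + 2 i)` of the `𝔰𝔩₂`-string. [folklore] -/
def sl2StringConst (m : ℕ) : ℕ → ℕ
  | 0 => 0
  | j + 1 => sl2StringConst m j + m + 2 * j

omit [Field k] in
/-- `c_{j+1} ≥ m`. [folklore] -/
lemma le_sl2StringConst_succ (m j : ℕ) : m ≤ sl2StringConst m (j + 1) := by
  induction j with
  | zero => simp [sl2StringConst]
  | succ j ih => simp only [sl2StringConst] at ih ⊢; omega

/-- **Positive-weight vectors killed by `ad e ∘ ad f` vanish** (an `𝔰𝔩₂`-string computation,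
avoiding both complete reducibility and the Casimir element). In an associative algebra over a field
of characteristic `0` let `e, f, h` satisfy `[h, e] = 2 e` and `[e, f] = h` (commutator brackets),
and let `v` be an `ad h`-eigenvector of weight `m ≥ 1` on which `ad e` is nilpotent. If
`[e, [f, v]] = 0` then `v = 0`. Proof: with `v_j = (ad e)^j v` (of weight `m + 2j`) and
`a_j = [f, v_j]` one has `a_{j+1} = [e, a_j] - (m + 2j) v_j`, whence `a_{j+1} = -c_{j+1} v_j` with
`c_{j+1} = ∑_{i ≤ j} (m + 2i) ≥ m > 0`; at the last non-zero `v_J` this reads `0 = -c_{J+1} v_J`.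
(Humphreys, *Introduction to Lie Algebras*, §7.2, Lemma; here for possibly reducible modules, and
without the relation `[h, f] = -2f`.) Compare `Literature/Algebra/Lie/Sl2Strings.lean`, the `End V`
version for Mathlib's `IsSl2Triple` over an algebraically closed field; the present statement is
the elementary associative-algebra form needed in `RootSpaceLine.lean`. [folklore] -/
theorem sl2_eq_zero_of_lie_e_lie_f_eq_zero [CharZero k] {e f h v : A}
    (hhe : h * e - e * h = (2 : k) • e) (hef : e * f - f * e = h) {m : ℕ} (hm : 1 ≤ m)
    (hv : h * v - v * h = (m : k) • v) (hnil : ∃ N : ℕ, (fun x => e * x - x * e)^[N] v = 0)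
    (hEF : e * (f * v - v * f) - (f * v - v * f) * e = 0) : v = 0 := by
  -- notation
  set E : A → A := fun x => e * x - x * e with hE
  -- the two relations, on vectors
  have hW : ∀ x : A, h * E x - E x * h = E (h * x - x * h) + (2 : k) • E x := by
    intro x
    have e1 : h * E x - E x * h = E (h * x - x * h) + ((h * e - e * h) * x - x * (h * e - e * h)) := by
      simp only [hE]; noncomm_ring
    rw [e1, hhe, smul_mul_assoc, mul_smul_comm, ← smul_sub]
  have hS : ∀ x : A, E (f * x - x * f) - (f * E x - E x * f) = h * x - x * h := by
    intro x
    have e1 : E (f * x - x * f) - (f * E x - E x * f) = (e * f - f * e) * x - x * (e * f - f * e) := by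
      simp only [hE]; noncomm_ring
    rw [e1, hef]
  -- weights along the string
  have hweight : ∀ j : ℕ, h * E^[j] v - E^[j] v * h = ((m : k) + 2 * j) • E^[j] v := by
    intro j
    induction j with
    | zero => simp [hv]
    | succ j ih =>
      rw [Function.iterate_succ_apply', hW, ih, hE]
      simp only [smul_sub, mul_smul_comm, smul_mul_assoc, Nat.cast_succ]
      module
  -- the string relation `[f, v_{j+1}] = -c_{j+1} v_j`
  have hstring : ∀ j : ℕ, f * E^[j + 1] v - E^[j + 1] v * f =
      -((sl2StringConst m (j + 1) : k) • E^[j] v) := by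
    intro j
    induction j with
    | zero =>
      have e1 := hS v
      rw [Function.iterate_succ_apply', Function.iterate_zero_apply]
      -- `[f, E v] = [e, [f, v]] - [h, v] = 0 - m v`
      have e2 : f * E v - E v * f = E (f * v - v * f) - (h * v - v * h) := by rw [← e1]; abel
      rw [e2]
      change e * (f * v - v * f) - (f * v - v * f) * e - (h * v - v * h) = _
      rw [hEF, hv, zero_sub, sl2StringConst, sl2StringConst]
      simp
    | succ j ih =>
      have e1 := hS (E^[j + 1] v)
      have e2 : f * E^[j + 1 + 1] v - E^[j + 1 + 1] v * f =
          E (f * E^[j + 1] v - E^[j + 1] v * f) - (h * E^[j + 1] v - E^[j + 1] v * h) := by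
        rw [Function.iterate_succ_apply' E (j + 1), ← e1]; abel
      rw [e2, ih, hweight (j + 1), Function.iterate_succ_apply' E j]
      have hlin : ∀ (c : k) (x : A), E (-(c • x)) = -(c • E x) := by
        intro c x; simp only [hE, mul_neg, neg_mul, mul_smul_comm, smul_mul_assoc, smul_sub]; abel
      have hc : (sl2StringConst m (j + 1 + 1) : k) =
          sl2StringConst m (j + 1) + m + 2 * ((j + 1 : ℕ) : k) := by
        simp [sl2StringConst]
      rw [hlin, hc]
      push_cast
      module
  -- the last non-zero vector of the string
  by_contra hv0
  classical
  obtain ⟨N, hN⟩ := hnil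
  have hex : ∃ N, E^[N] v = 0 := ⟨N, hN⟩
  let N₀ := Nat.find hex
  have hN₀ : E^[N₀] v = 0 := Nat.find_spec hex
  have hpos : 0 < N₀ := by
    rw [Nat.pos_iff_ne_zero]
    intro h0
    rw [h0, Function.iterate_zero_apply] at hN₀
    exact hv0 hN₀
  obtain ⟨J, hJ⟩ := Nat.exists_eq_add_one_of_ne_zero hpos.ne'
  have hJne : E^[J] v ≠ 0 := Nat.find_min hex (by omega)
  have hJ0 : E^[J + 1] v = 0 := hJ ▸ hN₀
  have key := hstring J
  rw [hJ0, mul_zero, zero_mul, sub_zero, eq_comm, neg_eq_zero, smul_eq_zero] at key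
  rcases key with hc | hc
  · have : (sl2StringConst m (J + 1) : k) ≠ 0 := by
      have := le_sl2StringConst_succ m J
      exact_mod_cast (show sl2StringConst m (J + 1) ≠ 0 by omega)
    exact this hc
  · exact hJne hc

end Sl2String

/-! ### The dimension count: `dim 𝔤_α ≤ 1` from an `𝔰𝔩₂`-datum -/

section Count

variable [CharZero k] [IsMulCommutative ↥T]

/-- **`dim S ≤ 1` for a space `S` of weight vectors of weight `α` carried by `ad f` into a space
`W ⊆ Lie(T)` on which `α` differentiates, in the presence of an `𝔰𝔩₂`-type triple.** Let `T` be
a commutative Zariski-connected subgroup of semisimple elements, `α ≠ 1` an algebraic character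
with polynomial `p`, `e ∈ (𝔤𝔩ₙ)_α` and `f, h` with `[h, e] = 2e`, `[e, f] = h`, `S ⊆ (𝔤𝔩ₙ)_α` a
subspace on which `ad h = 2` and which `ad f` maps into a subspace `W ⊆ Lie(T)`. Then
`dim S ≤ 1`: `ad f` is injective on `S` and its image meets
`K = {H ∈ W | dp_1(H) = 0} ⊆ {H | [H, e] = 0}` trivially (both by
`sl2_eq_zero_of_lie_e_lie_f_eq_zero`, `ad e` being nilpotent on weight vectors,
`exists_adIterate_eq_zero`), while `K` has codimension `≤ 1` in `W`. [folklore] -/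
theorem finrank_le_one_of_sl2Data [PerfectField k] (hss : ∀ t ∈ T, IsSemisimpleElt t)
    (hTc : IsZConnected T) {α : ↥T →* kˣ} (hα : IsAlgebraicChar α) (hα1 : α ≠ 1)
    {p : MvPolynomial (GLCoord n) k}
    (hp : ∀ t : ↥T, ((α t : kˣ) : k) = MvPolynomial.eval (glCoordFun (t : GL n k)) p)
    {W S : Submodule k (Matrix n n k)} (hW : W ≤ lieAlgebraGL T) (hS : S ≤ weightSpaceGL T α)
    {e f h : Matrix n n k} (he : e ∈ weightSpaceGL T α) (hhe : h * e - e * h = (2 : k) • e)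
    (hef : e * f - f * e = h) (hhv : ∀ v ∈ S, h * v - v * h = (2 : k) • v)
    (hfS : ∀ v ∈ S, f * v - v * f ∈ W) : Module.finrank k ↥S ≤ 1 := by
  -- `ad e` is nilpotent on `S`
  have hαm : ∀ m : ℕ, 0 < m → α ^ m ≠ 1 := fun m hm hαm =>
    hα1 (eq_one_of_isZConnected_of_pow_eq_one hTc hα hm.ne' hαm)
  have hnil : ∀ v ∈ S, ∃ N : ℕ, (fun x => e * x - x * e)^[N] v = 0 := fun v hv =>
    exists_adIterate_eq_zero hss hαm he (hS hv)
  -- the key vanishing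
  have hzero : ∀ v ∈ S, e * (f * v - v * f) - (f * v - v * f) * e = 0 → v = 0 := fun v hv hEF =>
    sl2_eq_zero_of_lie_e_lie_f_eq_zero hhe hef (m := 2) (by norm_num)
      (by rw [hhv v hv]; norm_num) (hnil v hv) hEF
  -- the commutator with `f` as a linear map (Mathlib's `LieAlgebra.ad` for the commutator bracket)
  let adf : Matrix n n k →ₗ[k] Matrix n n k := LinearMap.mulLeft k f - LinearMap.mulRight k f
  have adf_apply : ∀ y, adf y = f * y - y * f := fun y => rfl
  -- the subspaces
  set R : Submodule k (Matrix n n k) := S.map adf with hRdef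
  set K : Submodule k (Matrix n n k) := W ⊓ LinearMap.ker (tangentDerivLin p) with hKdef
  have hRW : R ≤ W := by
    rintro _ ⟨v, hv, rfl⟩
    exact hfS v hv
  have hKW : K ≤ W := inf_le_left
  have hRK : R ⊓ K = ⊥ := by
    rw [Submodule.eq_bot_iff]
    rintro x ⟨⟨v, hv, rfl⟩, hxK⟩
    have hx0 : adf v * e - e * adf v = 0 := by
      have h1 := lie_eq_tangentDeriv_smul_of_mem_weightSpaceGL hp he (hW (hKW hxK))
      have h2 : tangentDeriv p (adf v) = 0 := hxK.2
      rw [h1, h2, zero_smul]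
    have hv0 : v = 0 := hzero v hv (by
      rw [adf_apply] at hx0
      rw [← neg_eq_zero, ← hx0]; abel)
    rw [hv0, map_zero]
  -- dimensions
  have hinj : Module.finrank k ↥S = Module.finrank k ↥R := by
    have hker : LinearMap.ker (adf.domRestrict S) = ⊥ := by
      rw [LinearMap.ker_eq_bot']
      rintro ⟨v, hv⟩ h0
      have h0' : f * v - v * f = 0 := by
        rw [LinearMap.domRestrict_apply, adf_apply] at h0
        exact h0
      have : v = 0 := hzero v hv (by rw [h0', mul_zero, zero_mul, sub_zero])
      exact Subtype.ext this
    rw [hRdef, ← LinearMap.range_domRestrict]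
    exact (LinearMap.finrank_range_of_inj (LinearMap.ker_eq_bot.1 hker)).symm
  have hK : Module.finrank k ↥W ≤ Module.finrank k ↥K + 1 := by
    -- `K` is the kernel of the functional `dp_1` restricted to `W`
    set lam : ↥W →ₗ[k] k := (tangentDerivLin p).comp W.subtype with hlam
    have hrn := LinearMap.finrank_range_add_finrank_ker lam
    have hrange : Module.finrank k ↥(LinearMap.range lam) ≤ 1 :=
      (Submodule.finrank_le _).trans (by rw [Module.finrank_self])
    have hkerK : Module.finrank k ↥(LinearMap.ker lam) = Module.finrank k ↥K := by
      have hmap : (LinearMap.ker lam).map W.subtype = K := by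
        ext x
        simp only [Submodule.mem_map, LinearMap.mem_ker, hlam, LinearMap.coe_comp,
          Function.comp_apply, Submodule.coe_subtype, hKdef, Submodule.mem_inf]
        constructor
        · rintro ⟨y, hy, rfl⟩
          exact ⟨y.2, hy⟩
        · rintro ⟨hxW, hx⟩
          exact ⟨⟨x, hxW⟩, hx, rfl⟩
      rw [← hmap, Submodule.finrank_map_subtype_eq]
    omega
  have hsum : Module.finrank k ↥R + Module.finrank k ↥K ≤ Module.finrank k ↥W := by
    have h1 := Submodule.finrank_sup_add_finrank_inf_eq R K
    rw [hRK, finrank_bot, add_zero] at h1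
    rw [← h1]
    exact Submodule.finrank_mono (sup_le hRW hKW)
  omega

end Count

end Literature.NumberTheory.Automorphic
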